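import Summits.Ventures.HSemireg.WedgeHankelRecurrenceGaussChebyshevVajda

/-!
# Venture HSemireg — **THE EXTREMA OF `C_n` ON `[−2, 2]`: for `n ≠ 0` and `0 < k < n`, `x_k = 2cos(kπ∕n)` is a strict-sense local maximum of `C_n` when `k` is even and a local minimum when `k` is odd;
# for `k ≤ n`, `x_k` maximises (`k` even) resp. minimises (`k` odd) `C_n` on `[−2, 2]`** (transport of Mathlib's `isLocalMax_T_real ∕ isLocalMin_T_real ∕ isMaxOn_T_real ∕ isMinOn_T_real` along
# `C_n(x) = 2T_n(x∕2)`; the values there are `C_n(x_k) = 2(−1)^k`, N534)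

HONEST FRAMING. Part of the Lean index of the computation cell `pub-hsemireg` (seat p10 gen 49, Sunday typer «UNIFORM-IN-n»).  Real analysis of polynomial functions only (Mathlib `IsLocalMax ∕ IsLocalMin ∕
IsMaxOn ∕ IsMinOn`, `Polynomial.Chebyshev.T ∕ C` over `ℝ`); no variety, no cohomology theory, no sheaf, no Ext group and no semiregularity map is constructed here; nothing here says that HC / HC_CM /
HC_AV holds; no Literature fact (unproved `Prop`) is declared or used.  Custodian versions as in `WedgeHankelSiegelIdeal` (1/3).
SOURCES (cited).  T. J. Rivlin, *The Chebyshev Polynomials* (Wiley 1974), §1.2 (the extremal points `cos(kπ∕n)` of `T_n`) and §2.7; NIST DLMF §18.14(i).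
PROOF TYPED HERE.  `x ↦ x∕2` is continuous with `(2c)∕2 = c`, so Mathlib's local extremum of `T_n` at `c = cos(kπ∕n)` pulls back to a local extremum of `x ↦ T_n(x∕2)` at `2c` (`IsMaxFilter.comp_tendsto`);
composing with the monotone map `y ↦ 2y` (`IsLocalMax.comp_mono`) and rewriting with N521 `chebyshevC_eval_eq_two_mul_T_eval_half` gives the `C_n` statements; the `IsMaxOn ∕ IsMinOn` versions are
pointwise (`|x| ≤ 2 ⇒ |x∕2| ≤ 1`).
DEDUP DISCLOSURE (`rg -n 'IsLocalMax|IsLocalMin|IsMaxOn|IsMinOn' Summits/Ventures/HSemireg -g 'WedgeHankelRecurrenceGaussChebyshev*'` — none, 2026-09-04): Mathlib has the `T_n` statements (USED); N523 ∕ N534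
have the VALUE statements `C_n(x) = ±2 ↔ …`, `C_n(2cos(kπ∕n)) = 2(−1)^k`; the local ∕ global extremum statements for `C_n` are not typed; 0 hits for the 6 names below.

WHAT IS IN THE TREE.  N521 `chebyshevC_eval_eq_two_mul_T_eval_half`; Mathlib `Polynomial.Chebyshev.isLocalMax_T_real`, `isLocalMin_T_real`, `isMaxOn_T_real`, `isMinOn_T_real`, `IsMaxFilter.comp_tendsto`,
`IsMinFilter.comp_tendsto`, `IsLocalMax.comp_mono`, `IsLocalMin.comp_mono`, `Filter.Tendsto.div_const`.
THIS FILE (namespace `Summit.Ventures.HSemireg.Wedge.HankelOuter` continued; CHAINED on N546; 0 definitions):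
* §1312 `isLocalMax_comp_half`, `isLocalMin_comp_half` (pull-backs along `x ↦ x∕2`), **`isLocalMax_chebyshevC_real`** (`k` even, `0 < k < n`), **`isLocalMin_chebyshevC_real`** (`k` odd, `k < n`), **`isMaxOn_chebyshevC_real`** (`k` even, `k ≤ n`, on `[−2, 2]`),
  **`isMinOn_chebyshevC_real`** (`k` odd, `k ≤ n`, on `[−2, 2]`).
CAVEATS.  `n ∈ ℕ`, `n ≠ 0`.  Nothing Ext-side.  New names only.
-/

open Module Polynomial
open scoped Matrix Polynomial Topology

namespace Summit.Ventures.HSemireg.Wedge.HankelOuter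

/-! ## §1312. Local and global extrema of `C_n` on `[−2, 2]` -/

/-- Pull-back of a local maximum along `x ↦ x∕2`: `IsLocalMax f c → IsLocalMax (x ↦ f(x∕2)) (2c)`. [this file, §1312] -/
theorem isLocalMax_comp_half {f : ℝ → ℝ} {c : ℝ} (h : IsLocalMax f c) : IsLocalMax (fun x : ℝ => f (x / 2)) (2 * c) := by
  have h' : IsMaxFilter f (𝓝 (2 * c / 2)) (2 * c / 2) := by rw [show 2 * c / 2 = c by ring]; exact h
  exact IsMaxFilter.comp_tendsto (g := fun x : ℝ => x / 2) h' (Filter.tendsto_id.div_const 2)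

/-- Pull-back of a local minimum along `x ↦ x∕2`: `IsLocalMin f c → IsLocalMin (x ↦ f(x∕2)) (2c)`. [this file, §1312] -/
theorem isLocalMin_comp_half {f : ℝ → ℝ} {c : ℝ} (h : IsLocalMin f c) : IsLocalMin (fun x : ℝ => f (x / 2)) (2 * c) := by
  have h' : IsMinFilter f (𝓝 (2 * c / 2)) (2 * c / 2) := by rw [show 2 * c / 2 = c by ring]; exact h
  exact IsMinFilter.comp_tendsto (g := fun x : ℝ => x / 2) h' (Filter.tendsto_id.div_const 2)

/-- **`2cos(kπ∕n)` is a local maximum of `C_n` for even `k` with `0 < k < n`.** [Rivlin 1974, §1.2; this file, §1312] -/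
theorem isLocalMax_chebyshevC_real {n k : ℕ} (hn : n ≠ 0) (hk₀ : 0 < k) (hk₁ : k < n) (hk₂ : Even k) :
    IsLocalMax (fun x : ℝ => (Polynomial.Chebyshev.C ℝ (n : ℤ)).eval x) (2 * Real.cos (k * Real.pi / n)) := by
  have hT := Polynomial.Chebyshev.isLocalMax_T_real hn hk₀ hk₁ hk₂
  have h2 : IsLocalMax (fun x : ℝ => (Polynomial.Chebyshev.T ℝ (n : ℤ)).eval (x / 2)) (2 * Real.cos (k * Real.pi / n)) := isLocalMax_comp_half hT
  have h3 := h2.comp_mono (g := fun y : ℝ => 2 * y) (fun a b hab => by simp only; linarith)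
  refine (show (fun x : ℝ => (Polynomial.Chebyshev.C ℝ (n : ℤ)).eval x) = (fun y : ℝ => 2 * y) ∘ fun x : ℝ => (Polynomial.Chebyshev.T ℝ (n : ℤ)).eval (x / 2) from ?_) ▸ h3
  funext x
  simp only [Function.comp_apply, chebyshevC_eval_eq_two_mul_T_eval_half]

/-- **`2cos(kπ∕n)` is a local minimum of `C_n` for odd `k < n`.** [Rivlin 1974, §1.2; this file, §1312] -/
theorem isLocalMin_chebyshevC_real {n k : ℕ} (hn : n ≠ 0) (hk₁ : k < n) (hk₂ : Odd k) :
    IsLocalMin (fun x : ℝ => (Polynomial.Chebyshev.C ℝ (n : ℤ)).eval x) (2 * Real.cos (k * Real.pi / n)) := by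
  have hT := Polynomial.Chebyshev.isLocalMin_T_real hn hk₁ hk₂
  have h2 : IsLocalMin (fun x : ℝ => (Polynomial.Chebyshev.T ℝ (n : ℤ)).eval (x / 2)) (2 * Real.cos (k * Real.pi / n)) := isLocalMin_comp_half hT
  have h3 := h2.comp_mono (g := fun y : ℝ => 2 * y) (fun a b hab => by simp only; linarith)
  refine (show (fun x : ℝ => (Polynomial.Chebyshev.C ℝ (n : ℤ)).eval x) = (fun y : ℝ => 2 * y) ∘ fun x : ℝ => (Polynomial.Chebyshev.T ℝ (n : ℤ)).eval (x / 2) from ?_) ▸ h3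
  funext x
  simp only [Function.comp_apply, chebyshevC_eval_eq_two_mul_T_eval_half]

/-- **`2cos(kπ∕n)` maximises `C_n` on `[−2, 2]` for even `k ≤ n`** (the maximum value `2`). [Rivlin 1974, §1.2; this file, §1312] -/
theorem isMaxOn_chebyshevC_real {n k : ℕ} (hn : n ≠ 0) (hk₁ : k ≤ n) (hk₂ : Even k) :
    IsMaxOn (fun x : ℝ => (Polynomial.Chebyshev.C ℝ (n : ℤ)).eval x) (Set.Icc (-2) 2) (2 * Real.cos (k * Real.pi / n)) := by
  intro x hx
  have hT := Polynomial.Chebyshev.isMaxOn_T_real hn hk₁ hk₂ (show x / 2 ∈ Set.Icc (-1 : ℝ) 1 from ⟨by linarith [hx.1], by linarith [hx.2]⟩)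
  simp only [Set.mem_setOf_eq] at hT ⊢
  rw [chebyshevC_eval_eq_two_mul_T_eval_half, chebyshevC_eval_eq_two_mul_T_eval_half, show 2 * Real.cos (k * Real.pi / n) / 2 = Real.cos (k * Real.pi / n) by ring]
  linarith

/-- **`2cos(kπ∕n)` minimises `C_n` on `[−2, 2]` for odd `k ≤ n`** (the minimum value `−2`). [Rivlin 1974, §1.2; this file, §1312] -/
theorem isMinOn_chebyshevC_real {n k : ℕ} (hn : n ≠ 0) (hk₁ : k ≤ n) (hk₂ : Odd k) :
    IsMinOn (fun x : ℝ => (Polynomial.Chebyshev.C ℝ (n : ℤ)).eval x) (Set.Icc (-2) 2) (2 * Real.cos (k * Real.pi / n)) := by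
  intro x hx
  have hT := Polynomial.Chebyshev.isMinOn_T_real hn hk₁ hk₂ (show x / 2 ∈ Set.Icc (-1 : ℝ) 1 from ⟨by linarith [hx.1], by linarith [hx.2]⟩)
  simp only [Set.mem_setOf_eq] at hT ⊢
  rw [chebyshevC_eval_eq_two_mul_T_eval_half, chebyshevC_eval_eq_two_mul_T_eval_half, show 2 * Real.cos (k * Real.pi / n) / 2 = Real.cos (k * Real.pi / n) by ring]
  linarith

end Summit.Ventures.HSemireg.Wedge.HankelOuter
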